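import Literature.Topology.Immersions.OrientedPlaneBundleLineIso
import HarnessLib

/-!
# Transport of bundle orientations along isomorphisms

Topic `Literature/Topology/Immersions`. For an isomorphism of projection-field bundles
`Φ : E ≅ E'` (`ProjBundle.IsIso`, `ProjBundleIso.lean`) and an orientation `o'` of `E'`
(`ProjBundle.IsOrientation`, `ProjBundleOrientation.lean`), the **pulled-back orientation**
`Φ^* o'` of `E` — a frame `A` of `E_x` is positive iff `Φ_x ∘ A` is positive for `o'` — is an
orientation of `E`, and `Φ` preserves the orientations `(Φ^* o', o')` by construction
(Milnor–Stasheff, *Characteristic Classes* (1974), §9 p. 97: orientations are transported along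
bundle isomorphisms / induced on isomorphic bundles). With `OrientedPlaneBundleLineIso.lean` this
gives `e(E, Φ^* o') = e(E', o')`, and with `ProjBundleOrientationConnected.lean` (over a connected
base any orientation `o` of `E` is `± Φ^* o'`) the Euler classes of isomorphic oriented plane
bundles agree up to sign.

* `ProjBundle.frameTransition_comp_comp` — `Φ` does not change frame transitions;
* `ProjBundle.pullOrientation` (`Φ^* o'`), `pullOrientation_eq_iff` (frame independence),
  `ProjBundle.isOrientation_pullOrientation`, `ProjBundle.preservesOrientation_pullOrientation`;
* `ProjBundle.eulerClassOf_eq_of_isIso_pull` — `e(E, Φ^* o') = e(E', o')` for plane bundles.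

Everything here is proved; the definitions are data; no named facts.

## References

* J. Milnor, J. Stasheff, *Characteristic Classes* (1974), §9 pp. 96–97. [MilnorStasheff1974]
-/

open scoped Manifold ContDiff Topology
open Set Function Module Filter

noncomputable section

namespace Literature.Topology.Immersions

/-- Local notation: `𝔼 n` is the model Euclidean space `EuclideanSpace ℝ (Fin n)`. -/
local notation "𝔼 " n:arg => EuclideanSpace ℝ (Fin n)

open Literature.Topology.FourManifolds (leftInv leftInv_apply_self apply_leftInv_of_mem_range
  contDiffAt_leftInv)

namespace ProjBundle

variable {n m m' k : ℕ} {M : Type*} [TopologicalSpace M] [ChartedSpace (𝔼 n) M]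

/-! ### Orientation algebra -/

/-- For orientations `a, b, c` of a fibre: `a = b ↔ ((a = c) ↔ (b = c))`. [folklore] -/
theorem eq_iff_eq_iff (P : ProjBundle n m k M) {x : M} (a b c : Orientation ℝ (P.fibre x) (Fin k)) :
    a = b ↔ ((a = c) ↔ (b = c)) := by
  have hcard : Fintype.card (Fin k) = finrank ℝ (P.fibre x) := by
    rw [Fintype.card_fin]; exact (P.finrank_range x).symm
  constructor
  · rintro rfl; exact Iff.rfl
  · intro h
    by_cases hac : a = c
    · rw [hac, h.1 hac]
    · have hbc : b ≠ c := fun hb => hac (h.2 hb)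
      rw [(a.eq_or_eq_neg c hcard).resolve_left hac, (b.eq_or_eq_neg c hcard).resolve_left hbc]

/-! ### Frames pushed forward along an isomorphism -/

section Push

variable {P : ProjBundle n m k M} {P' : ProjBundle n m' k M} {Φ : M → 𝔼 m →L[ℝ] 𝔼 m'}

/-- The image `Φ_x ∘ A` of a frame of `E_x` under an isomorphism is injective. [folklore] -/
theorem injective_comp_frame (hiso : IsIso P P' Φ) {x : M} {A : 𝔼 k →L[ℝ] 𝔼 m}
    (hA : Injective A) (hr : LinearMap.range A.toLinearMap = P.fibre x) :
    Injective ((Φ x).comp A) := fun c c' h =>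
  hA (hiso.injOn x (hr ▸ LinearMap.mem_range_self _ c) (hr ▸ LinearMap.mem_range_self _ c') h)

/-- The image `Φ_x ∘ A` of a frame of `E_x` under an isomorphism spans `E'_x`. [folklore] -/
theorem range_comp_frame (hiso : IsIso P P' Φ) {x : M} {A : 𝔼 k →L[ℝ] 𝔼 m}
    (hr : LinearMap.range A.toLinearMap = P.fibre x) :
    LinearMap.range ((Φ x).comp A).toLinearMap = P'.fibre x := by
  apply le_antisymm
  · rintro _ ⟨c, rfl⟩
    exact hiso.mapsTo x _ (hr ▸ LinearMap.mem_range_self _ c)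
  · intro w hw
    obtain ⟨v, hv, rfl⟩ := (hiso.bijOn x).surjOn hw
    obtain ⟨c, rfl⟩ : v ∈ LinearMap.range A.toLinearMap := hr ▸ hv
    exact ⟨c, rfl⟩

/-- **An isomorphism does not change frame transitions**:
`frameTransition (Φ A) (Φ A') = frameTransition A A'`. [folklore] -/
theorem frameTransition_comp_comp (hiso : IsIso P P' Φ) {x : M} {A A' : 𝔼 k →L[ℝ] 𝔼 m}
    (hA : Injective A) (hr : LinearMap.range A.toLinearMap = P.fibre x)
    (hr' : LinearMap.range A'.toLinearMap = P.fibre x) :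
    frameTransition ((Φ x).comp A) ((Φ x).comp A') = frameTransition A A' := by
  ext1 c
  show leftInv ((Φ x).comp A) (Φ x (A' c)) = leftInv A (A' c)
  have hmem : A' c ∈ LinearMap.range A.toLinearMap := by rw [hr, ← hr']; exact LinearMap.mem_range_self _ c
  have hAc : A (leftInv A (A' c)) = A' c := apply_leftInv_of_mem_range hA hmem
  conv_lhs => rw [← hAc]
  exact leftInv_apply_self (injective_comp_frame hiso hA hr) _

/-- Equally oriented frames have equally oriented images. [folklore] -/
theorem orientationOfFrame_comp_eq_iff (hiso : IsIso P P' Φ) {x : M} {A A' : 𝔼 k →L[ℝ] 𝔼 m}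
    (hA : Injective A) (hA' : Injective A') (hr : LinearMap.range A.toLinearMap = P.fibre x)
    (hr' : LinearMap.range A'.toLinearMap = P.fibre x) :
    P'.orientationOfFrame ((Φ x).comp A) (injective_comp_frame hiso hA hr) (range_comp_frame hiso hr) =
        P'.orientationOfFrame ((Φ x).comp A') (injective_comp_frame hiso hA' hr')
          (range_comp_frame hiso hr') ↔
      P.orientationOfFrame A hA hr = P.orientationOfFrame A' hA' hr' := by
  rw [orientationOfFrame_eq_iff_det_pos, orientationOfFrame_eq_iff_det_pos,
    frameTransition_comp_comp hiso hA hr hr']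

end Push

/-! ### The pulled-back orientation -/

section Pull

variable (P : ProjBundle n m k M) (P' : ProjBundle n m' k M) (Φ : M → 𝔼 m →L[ℝ] 𝔼 m')
  (o' : ∀ x, Orientation ℝ (P'.fibre x) (Fin k))

/-- **The pulled-back orientation `Φ^* o'`**: the chart orientation of `E_x` if the image of the
chart frame is positive for `o'`, its opposite otherwise. [cite: MilnorStasheff1974, §9 p. 97] -/
def pullOrientation (hiso : IsIso P P' Φ) (x : M) : Orientation ℝ (P.fibre x) (Fin k) := by
  classical
  exact if P'.orientationOfFrame ((Φ x).comp (P.frameAt x x))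
      (injective_comp_frame hiso (P.mem_goodSet_self x).2 (P.range_frameAt_of_mem (P.mem_goodSet_self x)))
      (range_comp_frame hiso (P.range_frameAt_of_mem (P.mem_goodSet_self x))) = o' x
    then P.chartOrientation (P.mem_goodSet_self x) else -P.chartOrientation (P.mem_goodSet_self x)

variable {P P' Φ o'}

/-- **Frame independence**: `Φ^* o' (x)` is the orientation of a frame `A` of `E_x` iff `Φ_x ∘ A`
is positive for `o'`. [folklore] -/
theorem pullOrientation_eq_iff (hiso : IsIso P P' Φ) {x : M} {A : 𝔼 k →L[ℝ] 𝔼 m}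
    (hA : Injective A) (hr : LinearMap.range A.toLinearMap = P.fibre x) :
    pullOrientation P P' Φ o' hiso x = P.orientationOfFrame A hA hr ↔
      P'.orientationOfFrame ((Φ x).comp A) (injective_comp_frame hiso hA hr)
        (range_comp_frame hiso hr) = o' x := by
  classical
  have h0 := P.mem_goodSet_self x
  set A₀ := P.frameAt x x
  have hA₀ : Injective A₀ := h0.2
  have hr₀ : LinearMap.range A₀.toLinearMap = P.fibre x := P.range_frameAt_of_mem h0
  -- `t : O(A) = O(A₀)` iff the images are equally oriented
  have ht := orientationOfFrame_comp_eq_iff hiso hA hA₀ hr hr₀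
  have hC : P.chartOrientation h0 = P.orientationOfFrame A₀ hA₀ hr₀ := rfl
  unfold pullOrientation
  split_ifs with hs
  · -- `O'(Φ A₀) = o' x`
    rw [hC, eq_comm, ← ht, hs]
  · rw [hC]
    constructor
    · intro h
      -- `O(A) = -O(A₀)`, so `O'(ΦA) = -O'(ΦA₀) = o' x`
      have hne : P.orientationOfFrame A hA hr ≠ P.orientationOfFrame A₀ hA₀ hr₀ := by
        rw [← h]; exact fun h' => (Module.Ray.ne_neg_self _) h'.symm
      have hne' := fun h' => hne (ht.1 h')
      have e1 := (P'.neg_eq_iff_ne _ _).2 hne'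
      have e2 : -P'.orientationOfFrame ((Φ x).comp A₀) (injective_comp_frame hiso hA₀ hr₀)
          (range_comp_frame hiso hr₀) = o' x := (P'.neg_eq_iff_ne _ _).2 hs
      -- `O'(ΦA)` and `o' x` are both `≠ O'(ΦA₀)`'s opposite... use the trichotomy
      rw [P'.eq_iff_eq_iff _ (o' x) (P'.orientationOfFrame ((Φ x).comp A₀)
        (injective_comp_frame hiso hA₀ hr₀) (range_comp_frame hiso hr₀))]
      exact ⟨fun h' => absurd h' hne', fun h' => absurd h'.symm hs⟩
    · intro h
      rw [P.neg_eq_iff_ne]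
      intro h'
      apply hs
      rw [← ht.2 h'.symm]
      exact h

/-- **`Φ^* o'` is an orientation of `E`.** [cite: MilnorStasheff1974, §9 p. 97] -/
theorem isOrientation_pullOrientation (hiso : IsIso P P' Φ) (ho' : P'.IsOrientation o') :
    P.IsOrientation (pullOrientation P P' Φ o' hiso) := by
  refine ⟨fun x₀ => ?_⟩
  have hΦc : Continuous Φ := hiso.contMDiff.continuous
  -- frames: `A_x` (chart of `P` at `x₀`), `A'_x` (chart of `P'` at `x₀`)
  have hS : P.goodSet x₀ ∩ P'.goodSet x₀ ∈ 𝓝 x₀ :=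
    inter_mem ((P.isOpen_goodSet x₀).mem_nhds (P.mem_goodSet_self x₀))
      ((P'.isOpen_goodSet x₀).mem_nhds (P'.mem_goodSet_self x₀))
  -- `d x = det (frameTransition A'_x (Φ_x A_x))`, continuous and nonvanishing on the overlap
  let g : M → (𝔼 k →L[ℝ] 𝔼 k) := fun x => frameTransition (P'.frameAt x₀ x) ((Φ x).comp (P.frameAt x₀ x))
  have hg : ContinuousOn g (P.goodSet x₀ ∩ P'.goodSet x₀) := by
    have h1 : ContinuousOn (fun x => leftInv (P'.frameAt x₀ x)) (P.goodSet x₀ ∩ P'.goodSet x₀) :=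
      fun x hx => ((contDiffAt_leftInv hx.2.2).continuousAt.comp_continuousWithinAt
        (P'.continuous_frameAt x₀).continuousWithinAt)
    exact h1.clm_comp ((hΦc.clm_comp (P.continuous_frameAt x₀)).continuousOn)
  have hd : ContinuousOn (fun x => (g x).det) (P.goodSet x₀ ∩ P'.goodSet x₀) :=
    ContinuousLinearMap.continuous_det.comp_continuousOn hg
  have hne : ∀ x (hx : x ∈ P.goodSet x₀ ∩ P'.goodSet x₀), (g x).det ≠ 0 := fun x hx =>
    P'.det_frameTransition_ne_zero _ _ hx.2.2
      (injective_comp_frame hiso hx.1.2 (P.range_frameAt_of_mem hx.1))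
      (P'.range_frameAt_of_mem hx.2) (range_comp_frame hiso (P.range_frameAt_of_mem hx.1))
  have hx₀ : x₀ ∈ P.goodSet x₀ ∩ P'.goodSet x₀ := ⟨P.mem_goodSet_self x₀, P'.mem_goodSet_self x₀⟩
  have hda : ContinuousAt (fun x => (g x).det) x₀ := (hd x₀ hx₀).continuousAt hS
  have hsign : ∀ᶠ x in 𝓝 x₀, (0 < (g x).det ↔ 0 < (g x₀).det) := by
    rcases lt_or_gt_of_ne (hne x₀ hx₀) with hneg | hpos
    · filter_upwards [hda.eventually (gt_mem_nhds hneg)] with x hx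
      exact ⟨fun h' => absurd hx (not_lt.2 h'.le), fun h' => absurd hneg (not_lt.2 h'.le)⟩
    · filter_upwards [hda.eventually (lt_mem_nhds hpos)] with x hx
      exact ⟨fun _ => hpos, fun _ => hx⟩
  -- `[O'(Φ A_x) = C'_x]` is locally constant, and so is `[o' x = C'_x]` (by `ho'`)
  filter_upwards [hsign, ho'.eventually_iff x₀, hS] with x hsx hox hxS
  intro hxg
  have hxg' : x ∈ P'.goodSet x₀ := hxS.2
  rw [chartOrientation, chartOrientation]
  rw [pullOrientation_eq_iff hiso hxg.2 (P.range_frameAt_of_mem hxg),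
    pullOrientation_eq_iff hiso (P.mem_goodSet_self x₀).2 (P.range_frameAt_of_mem (P.mem_goodSet_self x₀))]
  -- rewrite both sides through the chart orientation `C'` of `P'`
  rw [P'.eq_iff_eq_iff _ (o' x) (P'.chartOrientation hxg'),
    P'.eq_iff_eq_iff _ (o' x₀) (P'.chartOrientation (P'.mem_goodSet_self x₀))]
  have e1 : (P'.orientationOfFrame ((Φ x).comp (P.frameAt x₀ x)) (injective_comp_frame hiso hxg.2
      (P.range_frameAt_of_mem hxg)) (range_comp_frame hiso (P.range_frameAt_of_mem hxg)) =
        P'.chartOrientation hxg') ↔ 0 < (g x).det := by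
    rw [eq_comm, chartOrientation, orientationOfFrame_eq_iff_det_pos]
  have e2 : (P'.orientationOfFrame ((Φ x₀).comp (P.frameAt x₀ x₀)) (injective_comp_frame hiso
      (P.mem_goodSet_self x₀).2 (P.range_frameAt_of_mem (P.mem_goodSet_self x₀)))
      (range_comp_frame hiso (P.range_frameAt_of_mem (P.mem_goodSet_self x₀))) =
        P'.chartOrientation (P'.mem_goodSet_self x₀)) ↔ 0 < (g x₀).det := by
    rw [eq_comm, chartOrientation, orientationOfFrame_eq_iff_det_pos]
  rw [e1, e2, hsx, hox hxg']

/-- **`Φ` preserves the orientations `(Φ^* o', o')`.** [cite: MilnorStasheff1974, §9 p. 97] -/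
theorem preservesOrientation_pullOrientation {P : ProjBundle n m 2 M} {P' : ProjBundle n m' 2 M}
    {Φ : M → 𝔼 m →L[ℝ] 𝔼 m'} {o' : ∀ x, Orientation ℝ (P'.fibre x) (Fin 2)} (hiso : IsIso P P' Φ) :
    PreservesOrientation P P' (pullOrientation P P' Φ o' hiso) o' Φ := by
  refine ⟨fun x A hA hr hA' hr' h => ?_⟩
  exact (pullOrientation_eq_iff hiso hA hr).1 h.symm

end Pull

/-! ### Euler classes of isomorphic plane bundles -/

section Euler

variable {M : Type} [TopologicalSpace M] [T2Space M] [ParacompactSpace M] [ChartedSpace (𝔼 n) M]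
  {P : ProjBundle n m 2 M} {P' : ProjBundle n m' 2 M} {Φ : M → 𝔼 m →L[ℝ] 𝔼 m'}
  {o' : ∀ x, Orientation ℝ (P'.fibre x) (Fin 2)}

/-- **`e(E, Φ^* o') = e(E', o')`** for an isomorphism `Φ : E ≅ E'` of plane bundles and an
orientation `o'` of `E'`. [cite: MilnorStasheff1974, §9 p. 97, §14 p. 155] -/
theorem eulerClassOf_eq_of_isIso_pull (hiso : IsIso P P' Φ) (ho' : P'.IsOrientation o') :
    P.eulerClassOf (pullOrientation P P' Φ o' hiso) (isOrientation_pullOrientation hiso ho') =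
      P'.eulerClassOf o' ho' :=
  eulerClassOf_eq_of_isIso _ ho' hiso (preservesOrientation_pullOrientation hiso)

end Euler

end ProjBundle

end Literature.Topology.Immersions
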